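import Literature.NumberTheory.EllipticCurves.RationalIsogenyFrobeniusCriterion
import Literature.NumberTheory.EllipticCurves.CyclicIsogenyCharacterFrobeniusProofs
import Literature.NumberTheory.EllipticCurves.RationalIsogenyFrobeniusCertificatesGenusOne
import HarnessLib

/-!
# Crux `MazurKenkuBound` (stmt-ABC-15125), line `Sketch` — stub `stub_eightyone`:
# no rational cyclic `81`-isogeny out of `j = -12288000 = -2¹⁵·3·5³`

Kenku 1982, proof of Thm. 1, the level `81 = 3·27` (the one composite level of case (c) covered
neither by Klein–Fricke nor by the two-subgroups lemma): a cyclic `ℚ`-isogeny of degree `81` has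
a `Γ_ℚ`-stable CYCLIC kernel `ℤP`, `P` of exact order `81 = 3⁴`. Transport `ℤP` along
`j(W) = j(E)` (`exists_zmultiples_stable_of_j_eq`) to the globally minimal CM model
`E = [0, 0, 1, -30, 63] ⊗ ℚ` (conductor `27`, `Δ = -3⁵`, `c₄ = 1440`, `c₆ = -54648`,
`j = c₄³/Δ = -12288000`); the character `r : Γ_ℚ → (ℤ/3⁴)ˣ` of `ℤP'` (Mazur 1978, §5) satisfies,
by Mazur 1978, Prop. 6.3 (1) in prime-power form at the good prime `ℓ = 7`
(`Mazur1978.exists_root_charpoly_mod_of_cyclicCharacter`), `r(φ₇)² − a₇ r(φ₇) + 7 ≡ 0 (mod 81)`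
with `a₇ = 7 + 1 − #Ẽ(𝔽₇) = -1` (kernel-decided `KenkuLevelsCert.card_E27_jm12288000_7`); but
`X² + X + 7` has no root modulo `81` (kernel-decided `KenkuLevelsCert.noroot_E27_jm12288000_7_81`).

The file proves the prime-power analogue of the tree's criterion
`j_ne_of_isogeny_prime_degree_of_certificate'` (`RationalIsogenyFrobeniusCriterion.lean`) —
same decidable integer data of one Weierstrass equation, with the isogeny character of a point of
prime order replaced by the character of a `Γ_ℚ`-stable cyclic subgroup of prime-power order
(`exists_cyclicCharacter_of_addOrderOf`, adapted from `Mazur1978.exists_isogenyCharacter`) — and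
feeds it the row `j = -12288000`.

## References

* [Mazur1978] B. Mazur, *Rational isogenies of prime degree*, Invent. Math. 44 (1978) 129–162:
  §5 p. 148 (the isogeny character), §6 Prop. 6.3 (1) (p. 153), table p. 129 (`X₀(27)`).
* [Kenku1982] M. A. Kenku, *On the number of ℚ-isomorphism classes of elliptic curves in each
  ℚ-isogeny class*, J. Number Theory 15 (1982) 199–202, proof of Thm. 1, the level `81`, p. 201.
-/

-- `Summit.ABC.ABC` is the mandated summit-side namespace (CONVENTIONS §2); the duplicate is deliberate.
set_option linter.dupNamespace false

noncomputable section

open scoped Classical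
open WeierstrassCurve
open Literature.NumberTheory.EllipticCurves

namespace Summit.ABC.ABC.Theorems

/-- **The character of a `Γ_F`-stable cyclic subgroup of any finite order** (Mazur 1978, §5,
p. 148, for a cyclic `N`-isogeny `(C_N, E)`: "the character `r : Gal(K̄/K) → Aut(C_N) = (ℤ/Nℤ)^*`
defined by the natural action of Galois on the cyclic subgroup `C_N`"). If `P ∈ E(F̄)` has exact
order `m` and `σP ∈ ℤP` for all `σ ∈ Γ_F`, there is a homomorphism `r : Γ_F → (ℤ/m)ˣ` with
`σP = r(σ)P`. The tree's `Mazur1978.exists_isogenyCharacter` is the case `m` prime (there the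
scalar is read off by `𝔽_m`-linear injectivity; here by `aP = bP ↔ a ≡ b (mod m)` for a point of
exact order `m`). [cite: Mazur1978, §5 (p. 148, definition of the isogeny character)] -/
private theorem exists_cyclicCharacter_of_addOrderOf {F : Type*} [Field F]
    (W : WeierstrassCurve F) {m : ℕ} [NeZero m] {P : geomPoints W} (hP : addOrderOf P = m)
    (hst : ∀ σ : Field.absoluteGaloisGroup F, σ • P ∈ AddSubgroup.zmultiples P) :
    ∃ r : Field.absoluteGaloisGroup F →* (ZMod m)ˣ,
      ∀ σ : Field.absoluteGaloisGroup F, σ • P = ((r σ : (ZMod m)ˣ) : ZMod m).val • P := by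
  -- equality of integer multiples of `P` is congruence modulo `m`
  have hiff : ∀ a b : ℤ, a • P = b • P ↔ (a : ZMod m) = (b : ZMod m) := fun a b ↦ by
    rw [zsmul_eq_zsmul_iff_modEq, hP, ZMod.intCast_eq_intCast_iff]
  have hval : ∀ k : ℤ, (k : ZMod m).val • P = k • P := fun k ↦ by
    rw [← natCast_zsmul, hiff, Int.cast_natCast, ZMod.natCast_zmod_val]
  -- the integer scalar by which `σ` acts on `P`
  have hex : ∀ σ : Field.absoluteGaloisGroup F, ∃ k : ℤ, k • P = σ • P := fun σ ↦
    AddSubgroup.mem_zmultiples_iff.mp (hst σ)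
  choose k hk using hex
  have hone : ((k 1 : ℤ) : ZMod m) = ((1 : ℤ) : ZMod m) := by
    rw [← hiff, hk, one_smul, one_zsmul]
  have hmul : ∀ σ τ, ((k (σ * τ) : ℤ) : ZMod m) = (k σ : ZMod m) * (k τ : ZMod m) := fun σ τ ↦ by
    rw [← Int.cast_mul, ← hiff, hk, mul_smul σ τ P, ← hk τ, smul_comm σ (k τ) P, ← hk σ,
      smul_smul, mul_comm]
  let r₀ : Field.absoluteGaloisGroup F →* ZMod m :=
    { toFun := fun σ ↦ (k σ : ZMod m)
      map_one' := hone.trans (Int.cast_one)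
      map_mul' := hmul }
  refine ⟨r₀.toHomUnits, fun σ ↦ ?_⟩
  rw [MonoidHom.coe_toHomUnits]
  show σ • P = ((k σ : ℤ) : ZMod m).val • P
  rw [hval, hk]

/-- **The Frobenius-certificate criterion against a rational CYCLIC isogeny of prime-power degree
`pᵏ`** (prime-power form of the tree's `j_ne_of_isogeny_prime_degree_of_certificate'`). Let
`E₀ = [a₁, a₂, a₃, a₄, a₆]` be an integer Weierstrass equation with `|Δ(E₀)| < B¹²` and `p¹² ∤ Δ`
or `p ∤ c₄` at every prime `p < B` (a global minimal equation), `c₄(E₀) ≠ 0`, `c₆(E₀) ≠ 0`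
(`j ≠ 0, 1728`), `ℓ ∤ Δ(E₀)` a prime (good reduction) with `#(E₀ mod ℓ)(𝔽_ℓ) = n`, and `p ≠ ℓ` a
prime such that `X² − (ℓ + 1 − n)X + ℓ` has no root in `ℤ/pᵏ`. Then no elliptic curve `W` over `ℚ`
with `j(W) = c₄(E₀)³/Δ(E₀)` has a cyclic `ℚ`-isogeny of degree `pᵏ`: a generator `P` of the
(cyclic, `Γ_ℚ`-stable) kernel has exact order `pᵏ` and `σP ∈ ℤP`; transported to `E₀ ⊗ ℚ` along
`j(W) = j(E₀ ⊗ ℚ)` (`exists_zmultiples_stable_of_j_eq`) it carries a character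
`r : Γ_ℚ → (ℤ/pᵏ)ˣ` (`exists_cyclicCharacter_of_addOrderOf`), and Mazur 1978, Prop. 6.3 (1) in
prime-power form (`Mazur1978.exists_root_charpoly_mod_of_cyclicCharacter`) gives a root of
`X² − a_ℓX + ℓ` modulo `pᵏ`, `a_ℓ = ℓ + 1 − n` (`frobeniusTrace_baseChange_int`).
[cite: Mazur1978, §6 Prop. 6.3 (1) (p. 153)] [cite: Kenku1982, proof of Thm. 1, case (c), p. 201] -/
private theorem j_ne_of_isogeny_cyclic_primePow_degree_of_certificate (E₀ : WeierstrassCurve ℤ)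
    {B : ℕ} (hB : E₀.Δ.natAbs < B ^ 12)
    (hdec : ∀ p ∈ Finset.range B, p.Prime →
      ¬ (p ^ 12 ∣ E₀.Δ.natAbs) ∨ ¬ (p ∣ E₀.c₄.natAbs))
    (hc₄ : E₀.c₄ ≠ 0) (hc₆ : E₀.c₆ ≠ 0)
    {ℓ : ℕ} [Fact ℓ.Prime] (hℓΔ : ¬ (ℓ ∣ E₀.Δ.natAbs)) {n : ℕ}
    (hcard : Nat.card ((E₀.map (Int.castRingHom (ZMod ℓ))).toAffine.Point) = n)
    {p k : ℕ} [Fact p.Prime] (hℓp : ℓ ≠ p)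
    (hnoroot : ∀ t : ZMod (p ^ k),
      t ^ 2 - (((ℓ : ℤ) + 1 - n : ℤ) : ZMod (p ^ k)) * t + (ℓ : ZMod (p ^ k)) ≠ 0)
    {W W' : WeierstrassCurve ℚ} [W.IsElliptic] [W'.IsElliptic] (ψ : Isogeny W W')
    (hψ : ψ.IsCyclic) (hq : ψ.degree = p ^ k) : W.j ≠ (E₀.c₄ : ℚ) ^ 3 / (E₀.Δ : ℚ) := by
  intro hj
  have hp : p.Prime := Fact.out
  haveI : NeZero (p ^ k) := ⟨pow_ne_zero _ hp.ne_zero⟩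
  -- the model `E = E₀ ⊗ ℚ`: elliptic, globally minimal, `j(E) = c₄³/Δ ≠ 0, 1728`, good at `ℓ`
  have hℓΔ' : ¬ ((ℓ : ℤ) ∣ E₀.Δ) := by rwa [Int.natCast_dvd]
  have hΔ : E₀.Δ ≠ 0 := fun h ↦ hℓΔ' (h ▸ dvd_zero _)
  haveI : (E₀.baseChange ℚ).IsElliptic := isElliptic_baseChange_int E₀ hΔ
  haveI : (E₀.baseChange ℚ).IsGloballyMinimal :=
    isGloballyMinimal_baseChange_int E₀ (forall_not_pow_dvd_or_of_bound E₀ hB hΔ hdec)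
  have hjE : W.j = (E₀.baseChange ℚ).j := by rw [j_baseChange_int]; exact hj
  have h0 : (E₀.baseChange ℚ).j ≠ 0 := j_baseChange_int_ne_zero E₀ hc₄
  have h1728 : (E₀.baseChange ℚ).j ≠ 1728 := j_baseChange_int_ne_1728 E₀ hc₆
  have hgood : (E₀.baseChange ℚ).HasGoodReductionAtPrime ℓ :=
    hasGoodReductionAtPrime_baseChange_int E₀ ℓ hℓΔ'
  -- (1) a generator `P = g` of the cyclic kernel: order `pᵏ`, `ker ψ = ℤP`, `Γ_ℚ`-stable
  haveI : IsAddCyclic ψ.toAddMonoidHom.ker := hψ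
  obtain ⟨g, hg⟩ := IsAddCyclic.exists_ofOrder_eq_natCard (α := ψ.toAddMonoidHom.ker)
  have hordP : addOrderOf (g : W.geomPoints) = p ^ k := by
    rw [AddSubgroup.addOrderOf_coe, hg]
    exact hq
  have hgen : AddSubgroup.zmultiples (g : W.geomPoints) = ψ.toAddMonoidHom.ker := by
    apply AddSubgroup.eq_of_le_of_card_ge (AddSubgroup.zmultiples_le.mpr g.2)
    rw [Nat.card_zmultiples, hordP]
    exact hq.le
  have hg0 : ψ (g : W.geomPoints) = 0 := (AddMonoidHom.mem_ker).mp g.2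
  have hst : ∀ σ : Field.absoluteGaloisGroup ℚ,
      σ • (g : W.geomPoints) ∈ AddSubgroup.zmultiples (g : W.geomPoints) := fun σ ↦ by
    rw [hgen, AddMonoidHom.mem_ker, Isogeny.coe_toAddMonoidHom, ψ.map_smul, hg0, smul_zero]
  -- (2) transport the stable cyclic subgroup to `E` along `j(W) = j(E)`
  obtain ⟨P', hord', hst'⟩ := exists_zmultiples_stable_of_j_eq hjE h0 h1728 _ hst
  rw [hordP] at hord'
  -- (3) its character, and Mazur's Prop. 6.3 (1) modulo `pᵏ` at the good prime `ℓ ≠ p`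
  obtain ⟨r, hr⟩ := exists_cyclicCharacter_of_addOrderOf (E₀.baseChange ℚ) hord' hst'
  obtain ⟨t, ht⟩ := Mazur1978.exists_root_charpoly_mod_of_cyclicCharacter (E₀.baseChange ℚ)
    p k ℓ hℓp hgood hord' hr
  rw [frobeniusTrace_baseChange_int E₀ hcard] at ht
  exact hnoroot t ht

/-- **Kenku 1982, the level `81`.** No elliptic curve over `ℚ` with `j = -12288000 = -2¹⁵·3·5³`
(the one non-cuspidal rational point of `X₀(27)`, CM by the order of discriminant `-27`) admits
a cyclic `ℚ`-isogeny of degree `81`: for the globally minimal model `[0, 0, 1, -30, 63]`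
(`Δ = -3⁵`, `c₄ = 1440`, `c₆ = -54648`) and the good prime `ℓ = 7` (`#Ẽ(𝔽₇) = 9`, `a₇ = -1`),
the character of the `Γ_ℚ`-stable cyclic kernel of order `3⁴` would produce a root of
`X² + X + 7` modulo `81` (Mazur 1978, Prop. 6.3 (1)), and there is none.
[cite: Mazur1978, §6 Prop. 6.3 (1) (p. 153)]
[cite: Kenku1982, proof of Thm. 1, the level 81, p. 201] -/
theorem stub_eightyone :
    ∀ (W W' : WeierstrassCurve ℚ) [W.IsElliptic] [W'.IsElliptic] (ψ : Isogeny W W'),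
      ψ.IsCyclic → ψ.degree = 81 → W.j ≠ -12288000 := by
  intro W W' _ _ ψ hψ hdeg
  have hj : (((⟨0, 0, 1, -30, 63⟩ : WeierstrassCurve ℤ)).c₄ : ℚ) ^ 3 /
      (((⟨0, 0, 1, -30, 63⟩ : WeierstrassCurve ℤ)).Δ : ℚ) = -12288000 := by
    norm_num [WeierstrassCurve.Δ, WeierstrassCurve.c₄, WeierstrassCurve.b₂, WeierstrassCurve.b₄,
      WeierstrassCurve.b₆, WeierstrassCurve.b₈]
  -- root-freeness of `X² − a₇X + 7 = X² + X + 7` modulo `3⁴ = 81`, read off from the kernel-decided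
  -- certificate in `ZMod 81` and restated in `ZMod (3 ^ 4)` BEFORE any local `Fact` instance
  have hnr : ∀ t : ZMod (3 ^ 4),
      t ^ 2 - ((((7 : ℕ) : ℤ) + 1 - (9 : ℕ) : ℤ) : ZMod (3 ^ 4)) * t + ((7 : ℕ) : ZMod (3 ^ 4))
        ≠ 0 := by
    have key : ∀ m : ℕ, m = 81 → ∀ t : ZMod m,
        t ^ 2 - ((((7 : ℕ) : ℤ) + 1 - (9 : ℕ) : ℤ) : ZMod m) * t + ((7 : ℕ) : ZMod m) ≠ 0 := by
      rintro m rfl t ht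
      refine KenkuLevelsCert.noroot_E27_jm12288000_7_81 t ?_
      push_cast at ht
      linear_combination ht
    exact key (3 ^ 4) (by norm_num)
  rw [← hj]
  haveI : Fact (Nat.Prime 7) := ⟨by norm_num⟩
  haveI : Fact (Nat.Prime 3) := ⟨by norm_num⟩
  exact j_ne_of_isogeny_cyclic_primePow_degree_of_certificate _ (B := 2) (by decide +kernel)
    (by decide +kernel) (by decide +kernel) (by decide +kernel) (ℓ := 7) (by decide +kernel)
    KenkuLevelsCert.card_E27_jm12288000_7 (p := 3) (k := 4) (by norm_num) hnr ψ hψ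
    (hdeg.trans (by norm_num))

end Summit.ABC.ABC.Theorems

end
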